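import Summits.QuantumFields.BalabanUV.Beta.RootedAveragingInversion

/-!
# `BalabanUV.Beta.RootedJetReflection` — the LEFT CHART WITH GENERAL BACKGROUND, the REFLECTED CHART DATA, and the
# μ ≠ α ∕ μ = α REFLECTION LAWS OF NODE 12's ROOTED AVERAGED JET `QjetAt`
# (β sub-cell, row D1 letter chain HR-W-LET, module M2b of an1's plan AN1-28B; an3 gen 33, an1 first refusal)

HONEST FRAMING (cell charter, verbatim): «discharging BetaPertH makes Bałaban's UV stability UNCONDITIONAL — a real
constructive-QFT result; it is NOT the continuum limit and NOT the Clay problem.»  HONEST DEPENDENCY (verbatim): «continuum YM on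
T⁴ ⇐ BetaPertH ∧ nine spine estimates (0/9 proved); BetaPertH ⇐ (D1) ∧ (D4) ∧ CAP+tail; G-an2-4 gates asym, D1 and NE2/3/4.»
DERIVED cell leaf: [folklore] ring algebra over node 12/12b (`Gf`/`Gb`, `PhiRAt`, `QjetAt`, `kσ`), an1's M1
`RootedHolonomyReflection{,Hol}` (p216288/p216407), the CUT `TruncatedNil4Calculus` (p220802) and M2a §2
`RootedAveragingInversion`, all imported BY NAME.  No statement of Bałaban's papers is typed here, no `[cite:]` tag, no `Prop`
is minted, no binder of the β-function wall (`hW`/`hR`/`D1Tel`/`D1Rep`, (D1), `BetaPertH`) is instantiated or discharged.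
NOT summit progress.

## What this module proves (an1's INTENT AN1-28B, M2b)

* §1 THE LEFT CHART WITH GENERAL BACKGROUND: `GfL ω E κ x := dmk 1 (ω κ x) * dmk (E κ x) 0`, `GbL ω Ē κ x := dmk (Ē κ x) 0 *
  dmk 1 (-ω κ x)` for ANY background letter pair `(E, Ē) : Form1 d (Tau 𝔸)`, the rooted averaging `PhiLAt` and jet `QjetLAt` on
  it; node 12's ordered chart is the instance `E = Ebg B B′`, `Ē = Ebi B B′` (`Gf_eq_GfL`, `PhiRAt_eq_PhiLAt`, `QjetAt_eq_QjetLAt`,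
  all `rfl`); inverse-pair, augmentation and `σ`-killing facts (`GbL_mul_GfL`, `augR_GfL`, `kσ_PhiLAt`, `snd_PhiLAt_zero`, …).
* §2 THE REFLECTED CHART DATA under the block-compatible axis reflection `α` (root `ctr d L`): the background pair reflects AS A
  LETTER PAIR, `E♯ = reflPair α (Ebg B B′) (Ebi B B′)`, `Ē♯ = reflPair α (Ebi B B′) (Ebg B B′)` — so on `α`-bonds the factors
  appear in REVERSED order `(1 − τ₂B′)(1 − τ₁B)` (the flip-chart defect) — and the fluctuation letter is the signed pull-back
  `R1g α ω`, `Ad`-ROTATED ON THE AXIS by the reflected background: `omegaR α ω B B′`.  Pointwise: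
  `reflPair α (Gf ω B B′) (Gb ω B B′) = GfL (omegaR α ω B B′) E♯` and `reflPair α (Gb ω B B′) (Gf ω B B′) = GbL (omegaR α ω B B′) Ē♯`.
* §3 μ ≠ α (from M1 `PhiGAt_sref_of_ne`): `QjetAt 𝕜 (ctr d L) ω B B′ L μ (sref α y) = QjetLAt 𝕜 (ctr d L) (omegaR α ω B B′) E♯ Ē♯ L μ y`.
* §4 μ = α (from M2a §2 `PhiGAt_reflPair_self_eq_invT`): with `y′ = bref α α y`, `P := (PhiRAt 𝕜 (ctr d L) 0 B B′ L α y′).fst`,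
  `P₀ := (PhiLAt 𝕜 (ctr d L) 0 E♯ Ē♯ L α y).fst` (`P · P₀ = 1 = P₀ · P`):
  `QjetLAt … (omegaR α ω B B′) E♯ Ē♯ L α y = −(P₀ · QjetAt 𝕜 (ctr d L) ω B B′ L α y′ · P)` and, equivalently,
  `QjetAt 𝕜 (ctr d L) ω B B′ L α y′ = −(P · QjetLAt … L α y · P₀)` — the jet version of `Φ^σ = invT Φ`, through the Lie-level
  identity `logT (invT Φ · invT (invT Φ₀)) = −(invT Φ₀ · logT (Φ · invT Φ₀) · Φ₀)` (`logT_invT_mul_invT_invT`, any `𝕜`-algebra with `h4`).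

## What is NOT here
No `ω`-linearity/centrality of `QjetLAt`, no `Ad`-expansion or `D`-splitting of the reversed background, no BCH, no table: M3–M5
of the plan.  Nothing about `mixFFAt`/`vh₂SAt`/`(hM2)`/`(hBe)` is proved in this file.
-/

namespace Summit.QuantumFields.BalabanUV.Beta.RootedJetReflection

open Finset
open scoped BigOperators
open Literature.MathematicalPhysics.QuantumFieldTheory.Balaban1983to89
open Literature.MathematicalPhysics.QuantumFieldTheory.Balaban1983to89.Beta
open AffineAveraging (Form1 box)
open AveragingContoursRooted (ctr)
open AveragingThirdJet (Tau Rho dmk fst_dmk snd_dmk dfst_mul dsnd_mul Ebg Ebi Gf Gb fst_Gf snd_Gf fst_Gb snd_Gb Gf_mul_Gb Gb_mul_Gf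
  Ebg_mul_Ebi Ebi_mul_Ebg c00_Ebg c00_Ebi augR augR_apply expT logT invT map_invT)
open AveragingThirdJet.Tau (c00)
open AveragingMixedJetTables (PhiGAt map_PhiGAt PhiRAt QjetAt kσ kσ_apply kσ_PhiRAt)
open ResolventReflection (sref bref)
open Summit.QuantumFields.BalabanUV.Beta.RootedHolonomyReflection (R1g R1g_of_ne)
open Summit.QuantumFields.BalabanUV.Beta.RootedHolonomyReflectionHol (reflPair reflPair_of_ne reflPair_self PhiGAt_sref_of_ne)
open Summit.QuantumFields.BalabanUV.Beta.TruncatedNil4Calculus (mul_invT_eq_one invT_mul_eq_one aug_invT_eq_one invT_invT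
  invT_mul_rev logT_invT aug_PhiGAt_eq_one nil4_augR)
open Summit.QuantumFields.BalabanUV.Beta.RootedAveragingInversion (PhiGAt_reflPair_self_eq_invT)

/-! ## §1 The left chart with general background -/

section Chart

variable (𝕜 : Type*) [Field 𝕜] {d : ℕ} {𝔸 : Type*} [Ring 𝔸] [Algebra 𝕜 𝔸]

/-- [folklore] THE LEFT CHART WITH GENERAL BACKGROUND, forward letter: `U_f = (1 + ρ ω̂_f) · E_f` for ANY background letter
`E_f ∈ Tau 𝔸`, as the element `(E_f, ω̂_f E_f)` of `Rho 𝔸`. -/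
def GfL (ω E : Form1 d (Tau 𝔸)) : Form1 d (Rho 𝔸) := fun κ x => dmk 1 (ω κ x) * dmk (E κ x) 0

/-- [folklore] … backward letter: `U_f⁻¹ = Ē_f · (1 − ρ ω̂_f)`, `Ē_f` the inverse background letter. -/
def GbL (ω Eb : Form1 d (Tau 𝔸)) : Form1 d (Rho 𝔸) := fun κ x => dmk (Eb κ x) 0 * dmk 1 (-ω κ x)

/-- [folklore] The rooted one-step averaging on the left chart with general background. -/
noncomputable def PhiLAt (ρ : Fin d → ℤ) (ω E Eb : Form1 d (Tau 𝔸)) (L : ℕ) (μ : Fin d) (y : Fin d → ℤ) : Rho 𝔸 :=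
  PhiGAt 𝕜 ρ (GfL ω E) (GbL ω Eb) L μ y

/-- [folklore] The rooted averaged jet on the left chart with general background: the `ρ`-coefficient of
`logT (Φ^ρ(ω̂; E, Ē) · invT (Φ^ρ(0; E, Ē)))`. -/
noncomputable def QjetLAt (ρ : Fin d → ℤ) (ω E Eb : Form1 d (Tau 𝔸)) (L : ℕ) (μ : Fin d) (y : Fin d → ℤ) : Tau 𝔸 :=
  (logT 𝕜 (PhiLAt 𝕜 ρ ω E Eb L μ y * invT (PhiLAt 𝕜 ρ 0 E Eb L μ y))).snd

variable {𝕜}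

omit [Algebra 𝕜 𝔸] in
/-- [folklore] BRIDGE: node 12's ordered chart is the left chart with background `Ebg B B′`. -/
theorem Gf_eq_GfL (ω : Form1 d (Tau 𝔸)) (B B' : Form1 d 𝔸) : Gf ω B B' = GfL ω (Ebg B B') := rfl

omit [Algebra 𝕜 𝔸] in
/-- [folklore] BRIDGE: … and its backward letter has background `Ebi B B′`. -/
theorem Gb_eq_GbL (ω : Form1 d (Tau 𝔸)) (B B' : Form1 d 𝔸) : Gb ω B B' = GbL ω (Ebi B B') := rfl

/-- [folklore] BRIDGE: `PhiRAt ρ ω B B′ = PhiLAt ρ ω (Ebg B B′) (Ebi B B′)` (`rfl`). -/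
theorem PhiRAt_eq_PhiLAt (ρ : Fin d → ℤ) (ω : Form1 d (Tau 𝔸)) (B B' : Form1 d 𝔸) (L : ℕ) (μ : Fin d) (y : Fin d → ℤ) :
    PhiRAt 𝕜 ρ ω B B' L μ y = PhiLAt 𝕜 ρ ω (Ebg B B') (Ebi B B') L μ y := rfl

/-- [folklore] BRIDGE: `QjetAt ρ ω B B′ = QjetLAt ρ ω (Ebg B B′) (Ebi B B′)` (`rfl`). -/
theorem QjetAt_eq_QjetLAt (ρ : Fin d → ℤ) (ω : Form1 d (Tau 𝔸)) (B B' : Form1 d 𝔸) (L : ℕ) (μ : Fin d) (y : Fin d → ℤ) :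
    QjetAt 𝕜 ρ ω B B' L μ y = QjetLAt 𝕜 ρ ω (Ebg B B') (Ebi B B') L μ y := rfl

section Letters

variable (ω E Eb : Form1 d (Tau 𝔸)) (κ : Fin d) (x : Fin d → ℤ)

omit [Algebra 𝕜 𝔸] in
/-- [folklore] Background part of the forward letter. -/
@[simp] theorem fst_GfL : (GfL ω E κ x).fst = E κ x := by simp [GfL]
omit [Algebra 𝕜 𝔸] in
/-- [folklore] Fluctuation part of the forward letter. -/
@[simp] theorem snd_GfL : (GfL ω E κ x).snd = ω κ x * E κ x := by simp [GfL]
omit [Algebra 𝕜 𝔸] in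
/-- [folklore] Background part of the backward letter. -/
@[simp] theorem fst_GbL : (GbL ω Eb κ x).fst = Eb κ x := by simp [GbL]
omit [Algebra 𝕜 𝔸] in
/-- [folklore] Fluctuation part of the backward letter. -/
@[simp] theorem snd_GbL : (GbL ω Eb κ x).snd = -(Eb κ x * ω κ x) := by simp [GbL]

omit [Algebra 𝕜 𝔸] in
/-- [folklore] `U_f⁻¹ U_f = 1` on the left chart whenever `Ē_f E_f = 1`. -/
theorem GbL_mul_GfL (h : Eb κ x * E κ x = 1) : GbL ω Eb κ x * GfL ω E κ x = 1 :=
  TrivSqZeroExt.ext (by simp [h]) (by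
    simp only [dsnd_mul, fst_GbL, snd_GfL, snd_GbL, fst_GfL, TrivSqZeroExt.snd_one, neg_mul, ← mul_assoc]
    exact add_neg_cancel _)

omit [Algebra 𝕜 𝔸] in
/-- [folklore] `U_f U_f⁻¹ = 1` on the left chart whenever `E_f Ē_f = 1`. -/
theorem GfL_mul_GbL (h : E κ x * Eb κ x = 1) : GfL ω E κ x * GbL ω Eb κ x = 1 :=
  TrivSqZeroExt.ext (by simp [h]) (by
    simp only [dsnd_mul, fst_GbL, snd_GfL, snd_GbL, fst_GfL, TrivSqZeroExt.snd_one, mul_neg]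
    rw [mul_assoc (ω κ x), h, ← mul_assoc, h]; simp)

/-- [folklore] The forward letter is `c00 (E_f)` modulo the augmentation ideal of `Rho 𝔸`. -/
theorem augR_GfL : augR 𝕜 (GfL ω E κ x) = c00 (E κ x) := by rw [augR_apply, fst_GfL]

/-- [folklore] The backward letter is `c00 (Ē_f)` modulo the augmentation ideal of `Rho 𝔸`. -/
theorem augR_GbL : augR 𝕜 (GbL ω Eb κ x) = c00 (Eb κ x) := by rw [augR_apply, fst_GbL]

/-- [folklore] Killing `σ` kills the fluctuation letter of the forward letter. -/
theorem kσ_GfL : kσ 𝕜 (GfL ω E κ x) = GfL 0 E κ x :=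
  TrivSqZeroExt.ext (by simp [kσ_apply]) (by simp [kσ_apply])

/-- [folklore] … and of the backward letter. -/
theorem kσ_GbL : kσ 𝕜 (GbL ω Eb κ x) = GbL 0 Eb κ x :=
  TrivSqZeroExt.ext (by simp [kσ_apply]) (by simp [kσ_apply])

end Letters

/-- [folklore] Killing `σ` on the left-chart averaging kills the fluctuation letter. -/
theorem kσ_PhiLAt (ρ : Fin d → ℤ) (ω E Eb : Form1 d (Tau 𝔸)) (L : ℕ) (μ : Fin d) (y : Fin d → ℤ) :
    kσ 𝕜 (PhiLAt 𝕜 ρ ω E Eb L μ y) = PhiLAt 𝕜 ρ 0 E Eb L μ y := by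
  rw [PhiLAt, PhiLAt, map_PhiGAt]; simp only [kσ_GfL, kσ_GbL]

/-- [folklore] The fluctuation-free averaging has no `ρ`-component. -/
theorem snd_PhiLAt_zero (ρ : Fin d → ℤ) (E Eb : Form1 d (Tau 𝔸)) (L : ℕ) (μ : Fin d) (y : Fin d → ℤ) :
    (PhiLAt 𝕜 ρ 0 E Eb L μ y).snd = 0 := by
  have h := congrArg TrivSqZeroExt.snd (kσ_PhiLAt (𝕜 := 𝕜) ρ 0 E Eb L μ y)
  rw [kσ_apply, snd_dmk] at h
  exact h.symm

/-- [folklore] … nor has its truncated inverse. -/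
theorem snd_invT_PhiLAt_zero (ρ : Fin d → ℤ) (E Eb : Form1 d (Tau 𝔸)) (L : ℕ) (μ : Fin d) (y : Fin d → ℤ) :
    (invT (PhiLAt 𝕜 ρ 0 E Eb L μ y)).snd = 0 := by
  have h := congrArg TrivSqZeroExt.snd (map_invT (kσ 𝕜) (PhiLAt 𝕜 ρ 0 E Eb L μ y))
  rw [kσ_PhiLAt, kσ_apply, snd_dmk] at h
  exact h.symm

/-- [folklore] `(PhiRAt ρ 0 B B′).snd = 0` (node 12's chart, by the bridge). -/
theorem snd_PhiRAt_zero (ρ : Fin d → ℤ) (B B' : Form1 d 𝔸) (L : ℕ) (μ : Fin d) (y : Fin d → ℤ) :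
    (PhiRAt 𝕜 ρ 0 B B' L μ y).snd = 0 :=
  snd_PhiLAt_zero (𝕜 := 𝕜) ρ (Ebg B B') (Ebi B B') L μ y

/-- [folklore] `(invT (PhiRAt ρ 0 B B′)).snd = 0`. -/
theorem snd_invT_PhiRAt_zero (ρ : Fin d → ℤ) (B B' : Form1 d 𝔸) (L : ℕ) (μ : Fin d) (y : Fin d → ℤ) :
    (invT (PhiRAt 𝕜 ρ 0 B B' L μ y)).snd = 0 :=
  snd_invT_PhiLAt_zero (𝕜 := 𝕜) ρ (Ebg B B') (Ebi B B') L μ y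

end Chart

/-! ## §2 The reflected chart data -/

section Reflected

variable {d : ℕ} {𝔸 : Type*} [Ring 𝔸]

/-- [folklore] THE REFLECTED FLUCTUATION LETTER: the signed pull-back `R1g α ω`, `Ad`-ROTATED ON THE AXIS by the reflected
background: `ω♯_κ(x) = ω_κ(sref x)` (`κ ≠ α`), `ω♯_α(x) = −Ē_α(x′) ω_α(x′) E_α(x′)`, `x′ = bref α α x`. -/
def omegaR (α : Fin d) (ω : Form1 d (Tau 𝔸)) (B B' : Form1 d 𝔸) : Form1 d (Tau 𝔸) := fun κ x =>
  if κ = α then -(Ebi B B' κ (bref α κ x) * ω κ (bref α κ x) * Ebg B B' κ (bref α κ x)) else ω κ (bref α κ x)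

/-- [folklore] Off the axis the reflected fluctuation letter is the signed pull-back `R1g α ω` (= `ω_κ ∘ sref α`). -/
theorem omegaR_of_ne {α κ : Fin d} (h : κ ≠ α) (ω : Form1 d (Tau 𝔸)) (B B' : Form1 d 𝔸) (x : Fin d → ℤ) :
    omegaR α ω B B' κ x = R1g α ω κ x := by
  rw [omegaR, if_neg h, R1g, if_neg h]

/-- [folklore] On the axis it is `R1g α ω` conjugated by the reflected background: `ω♯_α(x) = Ē_α(x′) · (R1g α ω)_α(x) · E_α(x′)`. -/
theorem omegaR_self (α : Fin d) (ω : Form1 d (Tau 𝔸)) (B B' : Form1 d 𝔸) (x : Fin d → ℤ) :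
    omegaR α ω B B' α x = Ebi B B' α (bref α α x) * R1g α ω α x * Ebg B B' α (bref α α x) := by
  rw [omegaR, if_pos rfl, R1g, if_pos rfl, mul_neg, neg_mul]

/-- [folklore] No fluctuation reflects to no fluctuation. -/
@[simp] theorem omegaR_zero (α : Fin d) (B B' : Form1 d 𝔸) : omegaR α (0 : Form1 d (Tau 𝔸)) B B' = 0 := by
  funext κ x; by_cases h : κ = α <;> simp [omegaR, h]

/-- [folklore] **THE REFLECTED FORWARD LETTER**: `reflPair α (Gf ω B B′) (Gb ω B B′) = GfL ω♯ E♯`, `E♯ = reflPair α (Ebg B B′) (Ebi B B′)`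
— off the axis the ordered chart at `sref x`; on the axis the BACKWARD letter of the partner bond, i.e. background `(1 − τ₂B′)(1 − τ₁B)`
in REVERSED order and fluctuation `Ad`-rotated behind it. -/
theorem reflPair_Gf_Gb (α : Fin d) (ω : Form1 d (Tau 𝔸)) (B B' : Form1 d 𝔸) :
    reflPair α (Gf ω B B') (Gb ω B B') = GfL (omegaR α ω B B') (reflPair α (Ebg B B') (Ebi B B')) := by
  funext κ x
  by_cases h : κ = α
  · subst h
    rw [reflPair_self, GfL, reflPair_self, omegaR, if_pos rfl, Gb]
    refine TrivSqZeroExt.ext (by simp) ?_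
    simp only [dsnd_mul, fst_dmk, snd_dmk, mul_one, add_zero, one_mul, zero_add, mul_neg, neg_mul, mul_assoc,
      Ebg_mul_Ebi]
  · rw [reflPair_of_ne h, GfL, reflPair_of_ne h, omegaR, if_neg h, ResolventReflection.bref_of_ne h, Gf]

/-- [folklore] **THE REFLECTED BACKWARD LETTER**: `reflPair α (Gb ω B B′) (Gf ω B B′) = GbL ω♯ Ē♯`, `Ē♯ = reflPair α (Ebi B B′) (Ebg B B′)`. -/
theorem reflPair_Gb_Gf (α : Fin d) (ω : Form1 d (Tau 𝔸)) (B B' : Form1 d 𝔸) :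
    reflPair α (Gb ω B B') (Gf ω B B') = GbL (omegaR α ω B B') (reflPair α (Ebi B B') (Ebg B B')) := by
  funext κ x
  by_cases h : κ = α
  · subst h
    rw [reflPair_self, GbL, reflPair_self, omegaR, if_pos rfl, Gf]
    refine TrivSqZeroExt.ext (by simp) ?_
    simp only [dsnd_mul, fst_dmk, snd_dmk, mul_one, add_zero, one_mul, zero_add, neg_neg, ← mul_assoc, Ebg_mul_Ebi]
  · rw [reflPair_of_ne h, GbL, reflPair_of_ne h, omegaR, if_neg h, ResolventReflection.bref_of_ne h, Gb]

end Reflected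

/-! ## §3 The μ ≠ α law of the rooted jet -/

section Transverse

variable (𝕜 : Type*) [Field 𝕜] {d : ℕ} {𝔸 : Type*} [Ring 𝔸] [Algebra 𝕜 𝔸] {L : ℕ} (hL : Odd L)
include hL

/-- [folklore] μ ≠ α, averaging: `PhiRAt (ctr d L) ω B B′ L μ (sref α y) = PhiLAt (ctr d L) ω♯ E♯ Ē♯ L μ y` (M1 `PhiGAt_sref_of_ne` on
the chart, read through §2). -/
theorem PhiRAt_sref_of_ne {α μ : Fin d} (h : μ ≠ α) (ω : Form1 d (Tau 𝔸)) (B B' : Form1 d 𝔸) (y : Fin d → ℤ) :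
    PhiRAt 𝕜 (ctr d L) ω B B' L μ (sref α y)
      = PhiLAt 𝕜 (ctr d L) (omegaR α ω B B') (reflPair α (Ebg B B') (Ebi B B')) (reflPair α (Ebi B B') (Ebg B B')) L μ y := by
  rw [PhiRAt, PhiGAt_sref_of_ne 𝕜 hL h, reflPair_Gf_Gb, reflPair_Gb_Gf, PhiLAt]

/-- [folklore] **THE μ ≠ α LAW OF THE ROOTED JET**: `QjetAt (ctr d L) ω B B′ L μ (sref α y) = QjetLAt (ctr d L) ω♯ E♯ Ē♯ L μ y`. -/
theorem QjetAt_sref_of_ne {α μ : Fin d} (h : μ ≠ α) (ω : Form1 d (Tau 𝔸)) (B B' : Form1 d 𝔸) (y : Fin d → ℤ) :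
    QjetAt 𝕜 (ctr d L) ω B B' L μ (sref α y)
      = QjetLAt 𝕜 (ctr d L) (omegaR α ω B B') (reflPair α (Ebg B B') (Ebi B B')) (reflPair α (Ebi B B') (Ebg B B')) L μ y := by
  rw [QjetAt, QjetLAt, PhiRAt_sref_of_ne 𝕜 hL h ω, PhiRAt_sref_of_ne 𝕜 hL h 0, omegaR_zero]

end Transverse

/-! ## §4 The μ = α law of the rooted jet -/

section Lie

variable {𝕜 : Type*} [Field 𝕜] {S S₀ : Type*} [Ring S] [Algebra 𝕜 S] [Ring S₀] [Algebra 𝕜 S₀] {ag : S →ₐ[𝕜] S₀}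
  (h4 : ∀ a b c e : S, ag a = 0 → ag b = 0 → ag c = 0 → ag e = 0 → a * b * c * e = 0) (h2 : (2 : 𝕜) ≠ 0)
include h4 h2

/-- [folklore] THE LIE-LEVEL SHADOW OF INVERSION: for `Φ`, `Φ₀` of augmentation one,
`logT (invT Φ · invT (invT Φ₀)) = −(invT Φ₀ · logT (Φ · invT Φ₀) · Φ₀)` — the right-trivialised jet of the inverse family is minus
the `Ad_{Φ₀⁻¹}`-conjugate of the jet. -/
theorem logT_invT_mul_invT_invT {Φ Φ₀ : S} (hΦ : ag Φ = 1) (hΦ₀ : ag Φ₀ = 1) :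
    logT 𝕜 (invT Φ * invT (invT Φ₀)) = -(invT Φ₀ * logT 𝕜 (Φ * invT Φ₀) * Φ₀) := by
  have hi : ag (invT Φ₀) = 1 := aug_invT_eq_one hΦ₀
  have h1 : invT Φ * Φ₀ = invT (invT Φ₀ * Φ) := by rw [invT_mul_rev h4 hi hΦ, invT_invT h4 hΦ₀]
  have h3 : invT Φ₀ * Φ = invT Φ₀ * (Φ * invT Φ₀) * Φ₀ := by
    rw [mul_assoc, mul_assoc, invT_mul_eq_one h4 hΦ₀, mul_one]
  rw [invT_invT h4 hΦ₀, h1, logT_invT h4 h2 (by rw [map_mul, hi, hΦ, one_mul]), h3,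
    AveragingThirdJet.logT_conj (𝕜 := 𝕜) (invT_mul_eq_one h4 hΦ₀) (mul_invT_eq_one h4 hΦ₀)]

end Lie

section Longitudinal

variable (𝕜 : Type*) [Field 𝕜] {d : ℕ} {𝔸 : Type*} [Ring 𝔸] [Algebra 𝕜 𝔸] {L : ℕ} (hL : Odd L) (h2 : (2 : 𝕜) ≠ 0)
include hL h2

/-- [folklore] μ = α, averaging: `PhiLAt (ctr d L) ω♯ E♯ Ē♯ L α y = invT (PhiRAt (ctr d L) ω B B′ L α (bref α α y))` (M2a §2 on the
chart: `augR ∘ Gf = 1`, `Gf · Gb = 1 = Gb · Gf`, `nil4_augR`). -/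
theorem PhiLAt_reflPair_self_eq_invT (α : Fin d) (ω : Form1 d (Tau 𝔸)) (B B' : Form1 d 𝔸) (y : Fin d → ℤ) :
    PhiLAt 𝕜 (ctr d L) (omegaR α ω B B') (reflPair α (Ebg B B') (Ebi B B')) (reflPair α (Ebi B B') (Ebg B B')) L α y
      = invT (PhiRAt 𝕜 (ctr d L) ω B B' L α (bref α α y)) := by
  rw [PhiLAt, ← reflPair_Gf_Gb, ← reflPair_Gb_Gf, PhiRAt]
  exact PhiGAt_reflPair_self_eq_invT (nil4_augR (𝕜 := 𝕜)) h2 hL (fun κ x => by simp) (fun κ x => by simp)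
    (fun κ x => Gf_mul_Gb ω B B' κ x) (fun κ x => Gb_mul_Gf ω B B' κ x) α y

/-- [folklore] … at `ω = 0`: `PhiLAt (ctr d L) 0 E♯ Ē♯ L α y = invT (PhiRAt (ctr d L) 0 B B′ L α (bref α α y))`. -/
theorem PhiLAt_reflPair_zero_eq_invT (α : Fin d) (B B' : Form1 d 𝔸) (y : Fin d → ℤ) :
    PhiLAt 𝕜 (ctr d L) 0 (reflPair α (Ebg B B') (Ebi B B')) (reflPair α (Ebi B B') (Ebg B B')) L α y
      = invT (PhiRAt 𝕜 (ctr d L) 0 B B' L α (bref α α y)) := by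
  have h := PhiLAt_reflPair_self_eq_invT 𝕜 hL h2 α (0 : Form1 d (Tau 𝔸)) B B' y
  rwa [omegaR_zero] at h

/-- [folklore] `P · P₀ = 1`: the backgrounds of the fluctuation-free averaging at `(α, y′)` and of its reflection at `(α, y)`. -/
theorem fst_PhiRAt_zero_mul_fst_PhiLAt_zero (α : Fin d) (B B' : Form1 d 𝔸) (y : Fin d → ℤ) :
    (PhiRAt 𝕜 (ctr d L) 0 B B' L α (bref α α y)).fst
      * (PhiLAt 𝕜 (ctr d L) 0 (reflPair α (Ebg B B') (Ebi B B')) (reflPair α (Ebi B B') (Ebg B B')) L α y).fst = 1 := by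
  have hΦ₀ : augR 𝕜 (PhiRAt 𝕜 (ctr d L) 0 B B' L α (bref α α y)) = 1 :=
    aug_PhiGAt_eq_one (fun κ x => by simp) (fun κ x => by simp) (ctr d L) L α _
  rw [PhiLAt_reflPair_zero_eq_invT 𝕜 hL h2, ← dfst_mul, mul_invT_eq_one (nil4_augR (𝕜 := 𝕜)) hΦ₀]
  rfl

/-- [folklore] `P₀ · P = 1`. -/
theorem fst_PhiLAt_zero_mul_fst_PhiRAt_zero (α : Fin d) (B B' : Form1 d 𝔸) (y : Fin d → ℤ) :
    (PhiLAt 𝕜 (ctr d L) 0 (reflPair α (Ebg B B') (Ebi B B')) (reflPair α (Ebi B B') (Ebg B B')) L α y).fst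
      * (PhiRAt 𝕜 (ctr d L) 0 B B' L α (bref α α y)).fst = 1 := by
  have hΦ₀ : augR 𝕜 (PhiRAt 𝕜 (ctr d L) 0 B B' L α (bref α α y)) = 1 :=
    aug_PhiGAt_eq_one (fun κ x => by simp) (fun κ x => by simp) (ctr d L) L α _
  rw [PhiLAt_reflPair_zero_eq_invT 𝕜 hL h2, ← dfst_mul, invT_mul_eq_one (nil4_augR (𝕜 := 𝕜)) hΦ₀]
  rfl

/-- [folklore] **THE μ = α LAW OF THE ROOTED JET** (reflected side): with `y′ = bref α α y`, `P = (Φ^{ρ_c}_{(α,y′)}(0; B, B′)).fst`,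
`P₀ = (Φ^{ρ_c}_{(α,y)}(0; E♯, Ē♯)).fst`:  `QjetLAt (ctr d L) ω♯ E♯ Ē♯ L α y = −(P₀ · QjetAt (ctr d L) ω B B′ L α y′ · P)`. -/
theorem QjetLAt_reflPair_self (α : Fin d) (ω : Form1 d (Tau 𝔸)) (B B' : Form1 d 𝔸) (y : Fin d → ℤ) :
    QjetLAt 𝕜 (ctr d L) (omegaR α ω B B') (reflPair α (Ebg B B') (Ebi B B')) (reflPair α (Ebi B B') (Ebg B B')) L α y
      = -((PhiLAt 𝕜 (ctr d L) 0 (reflPair α (Ebg B B') (Ebi B B')) (reflPair α (Ebi B B') (Ebg B B')) L α y).fst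
          * QjetAt 𝕜 (ctr d L) ω B B' L α (bref α α y) * (PhiRAt 𝕜 (ctr d L) 0 B B' L α (bref α α y)).fst) := by
  have hΦ : augR 𝕜 (PhiRAt 𝕜 (ctr d L) ω B B' L α (bref α α y)) = 1 :=
    aug_PhiGAt_eq_one (fun κ x => by simp) (fun κ x => by simp) (ctr d L) L α _
  have hΦ₀ : augR 𝕜 (PhiRAt 𝕜 (ctr d L) 0 B B' L α (bref α α y)) = 1 :=
    aug_PhiGAt_eq_one (fun κ x => by simp) (fun κ x => by simp) (ctr d L) L α _
  rw [QjetLAt, QjetAt, PhiLAt_reflPair_self_eq_invT 𝕜 hL h2, PhiLAt_reflPair_zero_eq_invT 𝕜 hL h2,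
    logT_invT_mul_invT_invT (nil4_augR (𝕜 := 𝕜)) h2 hΦ hΦ₀, TrivSqZeroExt.snd_neg, dsnd_mul, dsnd_mul, snd_invT_PhiRAt_zero, snd_PhiRAt_zero, zero_mul, add_zero, mul_zero, zero_add]

/-- [folklore] **THE μ = α LAW OF THE ROOTED JET** (an1's AN1-28B M2b, original side): `QjetAt (ctr d L) ω B B′ L α (bref α α y)
= −(P · QjetLAt (ctr d L) ω♯ E♯ Ē♯ L α y · P₀)` — the jet of the reflected configuration on the reflected axis bond is MINUS the
background-conjugated jet at the `bref`-partner. -/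
theorem QjetAt_bref_self (α : Fin d) (ω : Form1 d (Tau 𝔸)) (B B' : Form1 d 𝔸) (y : Fin d → ℤ) :
    QjetAt 𝕜 (ctr d L) ω B B' L α (bref α α y)
      = -((PhiRAt 𝕜 (ctr d L) 0 B B' L α (bref α α y)).fst
          * QjetLAt 𝕜 (ctr d L) (omegaR α ω B B') (reflPair α (Ebg B B') (Ebi B B')) (reflPair α (Ebi B B') (Ebg B B')) L α y
          * (PhiLAt 𝕜 (ctr d L) 0 (reflPair α (Ebg B B') (Ebi B B')) (reflPair α (Ebi B B') (Ebg B B')) L α y).fst) := by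
  have hPP₀ := fst_PhiRAt_zero_mul_fst_PhiLAt_zero 𝕜 hL h2 α B B' y
  rw [QjetLAt_reflPair_self 𝕜 hL h2]
  simp only [mul_neg, neg_mul, neg_neg, mul_assoc]
  rw [hPP₀, mul_one, ← mul_assoc, hPP₀, one_mul]

end Longitudinal

end Summit.QuantumFields.BalabanUV.Beta.RootedJetReflection
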